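import Literature.Topology.FourManifolds.HCobordismWallConnectedSum
import HarnessLib

/-!
# Annihilators under a Kronecker-type pairing: kernels versus images, graphs versus graphs

Topic `Literature/Topology/FourManifolds`; lattice algebra in the cone of the named fact
`Literature.Topology.FourManifolds.isHCobordant_of_equivalent_intersectionForm` (**Wall 1964,
Thm. 2**; C. T. C. Wall, *On simply-connected 4-manifolds*, J. London Math. Soc. 39 (1964)
141–149; `HCobordismDonaldson.lean`), companion of `HCobordismWallConnectedSum.lean` (Wall's
graph `K`) and `LatticeFormsLagrangian.lean` (the automorph carrying `L` to `K`).

Wall's proof of Thm. 2 moves freely between homology and cohomology of simply connected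
4-manifolds ("quadratic forms" on `H₂`, p. 141; `L` "the kernel of `H₂(∂V) → H₂(V)`", p. 145;
diffeomorphisms "inducing" automorphs of `H₂(∂V)`). In the tree the intersection form, Wall's `K`
(`graphSubmodule`) and the realisation of automorphs by diffeomorphisms
(`IsRealisedByDiffeomorph`, `f^*` on `H²/T`) are COHOMOLOGICAL, while the gluing computation of
`H₂(R)` (Mayer–Vietoris, `CobordismAttachmentHomology.lean`) is HOMOLOGICAL. The dictionary is
the Kronecker pairing `⟨-, -⟩ : H²(X; ℤ) × H₂(X; ℤ) → ℤ` (`kroneckerPairing`, natural: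
`⟨f^* a, c⟩ = ⟨a, f_* c⟩`, `kroneckerPairing_map`; perfect for simply connected `X`,
`kroneckerPairing_bijective_of_isZero`). This file proves the four pieces of PURE ALGEBRA that
dictionary needs, for an arbitrary bilinear pairing `κ : C →ₗ H →ₗ ℤ` between a "cohomology
lattice" `C` and a "homology lattice" `H` (annihilators are spelled out elementwise,
`∀ d ∈ D, κ a d = 0`, with `κ : C → Dual H`; no definition is introduced). The `ℤ`-specific
statements are proved for the canonical `ℤ`-module structures (sections `…Canonical`) and
exported for arbitrary `Module ℤ` instances by `Subsingleton (Module ℤ ·)` (section `Export`),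
the discipline of `HCobordismWallConnectedSum.lean`, since the consumers are the `ModuleCat`
carriers `H₂(·; ℤ)`, `H²(·; ℤ)/T`:

* `comap_dualAnnihilator_map_eq` — **naturality**: for adjoint maps `f_c`, `f_h`
  (`κ (f_c a) x = κ' a (f_h x)`), the annihilator of `f_h(S)` is the preimage under `f_c` of the
  annihilator of `S`. (So a diffeomorphism `f` with `f^*(ann L') = ann L` has `f_*(L) ⊆ L'`-type
  consequences.)
* `mem_ker_of_forall_pairing_eq_zero` — **biduality for kernels of maps to projective
  modules** (direct summands with projective quotient): if `D = ker (π : H → F)` with `F`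
  projective (e.g. free) and `κ` is onto `Dual H`, an element of `H` killed by every `a ∈ C`
  killing `D` lies in `D` — `ann_H (ann_C D) = D`. (Wall's `L = ker (H₂(∂V) → H₂(V))`,
  `H₂(V)` free.)
* `mem_range_iff_forall_mem_ker_pairing_eq_zero` — **the annihilator of a kernel is the image
  of the adjoint**: for `i_h : A_h → B_h` onto a projective `B_h`, with adjoint
  `i_c : B_c → A_c`, `κ_A` injective and `κ_B` onto, `ann (ker i_h) = range i_c`. (Wall's `L`:
  the annihilator of `ker (H₂(∂V) → H₂(V))` is the image of `H²(V) → H²(∂V)`, the tree's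
  cohomological `L` of `WallHandlebodyBoundary.lean`.)
* `pairing_eq_zero_of_mem_graphSubmodule`, `graphSubmodule_le_ker_of_forall` — **the
  homological graph of `−α†` pairs to zero with the cohomological graph of `α`**: for
  decompositions `W_c ≅ C₁ ⊕ C₂`, `W_h ≅ H₁ ⊕ H₂` paired summand-wise
  (`κ w x = κ₁ (s_c w) (s_h x) + κ₂ (t_c w) (t_h x)`) and `α : C₁ → C₂` with adjoint
  `α† : H₂ → H₁` (`κ₂ (α a) y = κ₁ a (α† y)`), every `x` with `s_h x = −α† (t_h x)` is killed by
  every `w` with `t_c w = α (s_c w)` (Wall's "`xx′ − yy′ = 0`" read across the pairing). With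
  biduality this puts the homological graph inside any summand whose annihilator is Wall's `K`.

Everything is proved; no named fact and no definition is introduced.

## References

* C. T. C. Wall, *On simply-connected 4-manifolds*, J. London Math. Soc. 39 (1964) 141–149, §2
  pp. 144–146. [WallJLMS1964]
* A. Hatcher, *Algebraic Topology*, CUP (2002), §3.1 pp. 191–201 (Kronecker pairing, universal
  coefficients, naturality). [HatcherAT2002]
-/

open Function Module

noncomputable section

namespace Literature.Topology.FourManifolds

/-! ### Naturality of annihilators -/

section Naturality

variable {C C' H H' : Type*} [AddCommGroup C] [Module ℤ C] [AddCommGroup C'] [Module ℤ C']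
  [AddCommGroup H] [Module ℤ H] [AddCommGroup H'] [Module ℤ H']

/-- **Naturality of annihilators**: if `f_c : C' → C` and `f_h : H → H'` are adjoint for the
pairings `κ : C → Dual H`, `κ' : C' → Dual H'` (`κ (f_c a) x = κ' a (f_h x)`, as `f^*`, `f_*` are
for the Kronecker pairing, Hatcher 2002 p. 201), then `a ∈ C'` kills `f_h (S)` iff `f_c a` kills
`S`. (Arbitrary `Module ℤ` instances: no `ℤ`-specific structure is used.)
[cite: HatcherAT2002, §3.1 p. 201] -/
theorem forall_map_pairing_eq_zero_iff (κ : C →ₗ[ℤ] Dual ℤ H) (κ' : C' →ₗ[ℤ] Dual ℤ H')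
    {fc : C' →ₗ[ℤ] C} {fh : H →ₗ[ℤ] H'} (hadj : ∀ a x, κ (fc a) x = κ' a (fh x))
    (S : Submodule ℤ H) (a : C') :
    (∀ y ∈ S.map fh, κ' a y = 0) ↔ ∀ x ∈ S, κ (fc a) x = 0 := by
  simp only [Submodule.mem_map, forall_exists_index, and_imp, forall_apply_eq_imp_iff₂, hadj]

/-- Naturality of annihilators, submodule form: the `κ'`-annihilator of `f_h (S)` is the preimage
under `f_c` of the `κ`-annihilator of `S`. [cite: HatcherAT2002, §3.1 p. 201] -/
theorem comap_dualAnnihilator_map_eq (κ : C →ₗ[ℤ] Dual ℤ H) (κ' : C' →ₗ[ℤ] Dual ℤ H')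
    {fc : C' →ₗ[ℤ] C} {fh : H →ₗ[ℤ] H'} (hadj : ∀ a x, κ (fc a) x = κ' a (fh x))
    (S : Submodule ℤ H) :
    (S.map fh).dualAnnihilator.comap κ' = (S.dualAnnihilator.comap κ).comap fc := by
  ext a
  simp only [Submodule.mem_comap, Submodule.mem_dualAnnihilator]
  exact forall_map_pairing_eq_zero_iff κ κ' hadj S a

end Naturality

/-! ### Biduality for kernels of maps to projective modules -/

section BidualityCanonical

variable {C H F : Type*} [AddCommGroup C] [AddCommGroup H] [AddCommGroup F]

/-- **Biduality for the kernel of a map onto-or-into a projective module**, canonical `ℤ`-module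
structures: if `κ : C → Dual H` is onto (as the Kronecker map `H² → Hom(H₂, ℤ)` is, Hatcher 2002
Thm. 3.2) and `π : H → F` is linear with `F` projective (e.g. free), then an `x ∈ H` killed by
every `a ∈ C` which kills `ker π` lies in `ker π`: otherwise some functional `g` of `F` has
`g (π x) ≠ 0` (`Module.Projective.exists_dual_ne_zero`), and `g ∘ π = κ a` kills `ker π` but not
`x`. Over `ℤ` the projectivity hypothesis cannot be dropped (`2ℤ = ker (ℤ → ℤ/2)`).
[cite: HatcherAT2002, §3.1 Thm. 3.2 (p. 195)] -/
theorem mem_ker_of_forall_pairing_eq_zero_canonical [Module.Projective ℤ F]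
    (κ : C →ₗ[ℤ] Dual ℤ H) (hκ : Surjective κ) (π : H →ₗ[ℤ] F) {x : H}
    (hx : ∀ a : C, (∀ d ∈ LinearMap.ker π, κ a d = 0) → κ a x = 0) : x ∈ LinearMap.ker π := by
  by_contra hxπ
  rw [LinearMap.mem_ker] at hxπ
  obtain ⟨g, hg⟩ := Module.Projective.exists_dual_ne_zero ℤ hxπ
  obtain ⟨a, ha⟩ := hκ (g ∘ₗ π)
  refine hg ?_
  have h1 : κ a x = g (π x) := by rw [ha]; rfl
  rw [← h1]
  refine hx a fun d hd => ?_
  rw [ha, LinearMap.comp_apply, LinearMap.mem_ker.1 hd, map_zero]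

end BidualityCanonical

/-! ### The annihilator of a kernel is the image of the adjoint -/

section KernelImageCanonical

variable {Ac Bc Ah Bh : Type*} [AddCommGroup Ac] [AddCommGroup Bc] [AddCommGroup Ah]
  [AddCommGroup Bh]

/-- **The annihilator of a kernel is the image of the adjoint** (Wall 1964, p. 145: "`L` is the
kernel of the map induced by the quadratic form … `L` is its own annihilator"; here the general
dictionary entry), canonical `ℤ`-module structures: let `i_h : A_h → B_h` be onto a projective
`B_h` (as `H₂(∂V) → H₂(V) ≅ ℤᵏ` for a handlebody on `0`- and `2`-handles) with adjoint
`i_c : B_c → A_c` (`κ_A (i_c b) x = κ_B b (i_h x)`, naturality of the Kronecker pairing),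
`κ_A : A_c → Dual A_h` one-to-one and `κ_B : B_c → Dual B_h` onto (universal coefficients).
Then `a ∈ A_c` kills `ker i_h` iff `a ∈ range i_c`: a functional killing `ker i_h` factors
through `i_h` by a linear section of `i_h` (`Module.projective_lifting_property`).
[cite: WallJLMS1964, §2 p. 145] [cite: HatcherAT2002, §3.1 pp. 195–201] -/
theorem mem_range_iff_forall_mem_ker_pairing_eq_zero_canonical [Module.Projective ℤ Bh]
    (κA : Ac →ₗ[ℤ] Dual ℤ Ah) (κB : Bc →ₗ[ℤ] Dual ℤ Bh) {ih : Ah →ₗ[ℤ] Bh} (hih : Surjective ih)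
    {ic : Bc →ₗ[ℤ] Ac} (hadj : ∀ b x, κA (ic b) x = κB b (ih x)) (hκA : Injective κA)
    (hκB : Surjective κB) (a : Ac) :
    a ∈ LinearMap.range ic ↔ ∀ x ∈ LinearMap.ker ih, κA a x = 0 := by
  constructor
  · rintro ⟨b, rfl⟩ x hx
    rw [hadj, LinearMap.mem_ker.1 hx, map_zero]
  · intro ha
    -- a linear section `σ` of `ih` (`B_h` projective) and the functional `κA a ∘ σ` on `B_h`
    obtain ⟨σ, hσ⟩ := Module.projective_lifting_property ih LinearMap.id hih
    obtain ⟨b, hb⟩ := hκB (κA a ∘ₗ σ)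
    refine ⟨b, hκA ?_⟩
    ext x
    -- `σ (ih x) - x ∈ ker ih`, so `κA a (σ (ih x)) = κA a x`
    have hk : σ (ih x) - x ∈ LinearMap.ker ih := by
      rw [LinearMap.mem_ker, map_sub, ← LinearMap.comp_apply, hσ, LinearMap.id_apply, sub_self]
    have h0 := ha _ hk
    rw [map_sub, sub_eq_zero] at h0
    rw [hadj, hb, LinearMap.comp_apply, h0]

end KernelImageCanonical

/-! ### The homological graph of `−α†` pairs to zero with Wall's `K` -/

section Graph

variable {C₁ C₂ Wc H₁ H₂ Wh : Type*} [AddCommGroup C₁] [Module ℤ C₁] [AddCommGroup C₂]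
  [Module ℤ C₂] [AddCommGroup Wc] [Module ℤ Wc] [AddCommGroup H₁] [Module ℤ H₁]
  [AddCommGroup H₂] [Module ℤ H₂] [AddCommGroup Wh] [Module ℤ Wh]

/-- **The homological graph of `−α†` is killed by the cohomological graph `K` of `α`** (Wall
1964, p. 145, "their intersection number is `xx′ − yy′ = xx′ − αx·αx′ = 0`", read across the
Kronecker pairing): for a pairing `κ : W_c × W_h → ℤ` decomposed summand-wise along
`W_c ≅ C₁ ⊕ C₂`, `W_h ≅ H₁ ⊕ H₂` (`κ w x = κ₁ (s_c w) (s_h x) + κ₂ (t_c w) (t_h x)`, as for a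
connected sum) and `α : C₁ → C₂` with adjoint `α† : H₂ → H₁` (`κ₂ (α a) y = κ₁ a (α† y)`),
every `w` in `K = graphSubmodule s_c t_c α` (`t_c w = α (s_c w)`) pairs to zero with every `x` in
`graphSubmodule t_h s_h (−α†)` (`s_h x = −α† (t_h x)`). (Arbitrary `Module ℤ` instances.)
[cite: WallJLMS1964, §2 p. 145] -/
theorem pairing_eq_zero_of_mem_graphSubmodule (κ : Wc →ₗ[ℤ] Wh →ₗ[ℤ] ℤ) (κ₁ : C₁ →ₗ[ℤ] H₁ →ₗ[ℤ] ℤ)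
    (κ₂ : C₂ →ₗ[ℤ] H₂ →ₗ[ℤ] ℤ) {sc : Wc →ₗ[ℤ] C₁} {tc : Wc →ₗ[ℤ] C₂} {sh : Wh →ₗ[ℤ] H₁}
    {th : Wh →ₗ[ℤ] H₂} (hκ : ∀ w x, κ w x = κ₁ (sc w) (sh x) + κ₂ (tc w) (th x))
    {e : C₁ →ₗ[ℤ] C₂} {e' : H₂ →ₗ[ℤ] H₁} (he : ∀ a y, κ₂ (e a) y = κ₁ a (e' y))
    {w : Wc} (hw : w ∈ graphSubmodule sc tc e) {x : Wh} (hx : x ∈ graphSubmodule th sh (-e')) :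
    κ w x = 0 := by
  rw [mem_graphSubmodule_iff] at hw hx
  rw [hκ, hw, hx, he, LinearMap.neg_apply, map_neg, neg_add_cancel]

end Graph

section GraphCanonical

variable {C₁ C₂ Wc H₁ H₂ Wh F : Type*} [AddCommGroup C₁] [AddCommGroup C₂] [AddCommGroup Wc]
  [AddCommGroup H₁] [AddCommGroup H₂] [AddCommGroup Wh] [AddCommGroup F]

/-- **Hence the homological graph lies in every kernel whose annihilator lies in `K`**
(canonical `ℤ`-module structures): with `κ` onto `Dual W_h`, `π : W_h → F` linear into a
projective `F`, and every `a ∈ W_c` killing `ker π` lying in `K = graphSubmodule s_c t_c α`,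
one has `graphSubmodule t_h s_h (−α†) ⊆ ker π` (biduality, `mem_ker_of_forall_pairing_eq_zero`,
and `pairing_eq_zero_of_mem_graphSubmodule`). Wall 1964, p. 146: after re-gluing `V` by a
diffeomorphism carrying `L` to `K`, "the kernel of `H₂(∂V) → H₂(V)` is `L = K`, the set of pairs
`(x, y)` … with `αx = y`" — here only the inclusion of the graph in the kernel, which is what the
surjectivity of `H₂(Mᵢ) → H₂(R)` consumes. [cite: WallJLMS1964, §2 p. 146] -/
theorem graphSubmodule_le_ker_of_forall_canonical [Module.Projective ℤ F]
    (κ : Wc →ₗ[ℤ] Wh →ₗ[ℤ] ℤ) (hκs : Surjective κ) (κ₁ : C₁ →ₗ[ℤ] H₁ →ₗ[ℤ] ℤ)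
    (κ₂ : C₂ →ₗ[ℤ] H₂ →ₗ[ℤ] ℤ) {sc : Wc →ₗ[ℤ] C₁} {tc : Wc →ₗ[ℤ] C₂} {sh : Wh →ₗ[ℤ] H₁}
    {th : Wh →ₗ[ℤ] H₂} (hκ : ∀ w x, κ w x = κ₁ (sc w) (sh x) + κ₂ (tc w) (th x))
    {e : C₁ →ₗ[ℤ] C₂} {e' : H₂ →ₗ[ℤ] H₁} (he : ∀ a y, κ₂ (e a) y = κ₁ a (e' y))
    (π : Wh →ₗ[ℤ] F)
    (hK : ∀ a : Wc, (∀ d ∈ LinearMap.ker π, κ a d = 0) → a ∈ graphSubmodule sc tc e) :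
    graphSubmodule th sh (-e') ≤ LinearMap.ker π := fun _ hx =>
  mem_ker_of_forall_pairing_eq_zero_canonical κ hκs π fun a ha =>
    pairing_eq_zero_of_mem_graphSubmodule κ κ₁ κ₂ hκ he (hK a ha) hx

end GraphCanonical

/-! ### Export for arbitrary `Module ℤ` instances -/

section Export

/-- **Biduality for the kernel of a map to a projective module**, arbitrary `Module ℤ` instances
(see `mem_ker_of_forall_pairing_eq_zero_canonical`). [cite: HatcherAT2002, §3.1 Thm. 3.2 (p. 195)] -/
theorem mem_ker_of_forall_pairing_eq_zero {C H F : Type*} [AddCommGroup C] [iC : Module ℤ C]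
    [AddCommGroup H] [iH : Module ℤ H] [AddCommGroup F] [iF : Module ℤ F] [Module.Projective ℤ F]
    (κ : C →ₗ[ℤ] Dual ℤ H) (hκ : Surjective κ) (π : H →ₗ[ℤ] F) {x : H}
    (hx : ∀ a : C, (∀ d ∈ LinearMap.ker π, κ a d = 0) → κ a x = 0) : x ∈ LinearMap.ker π := by
  obtain rfl : iC = AddCommGroup.toIntModule _ := Subsingleton.elim _ _
  obtain rfl : iH = AddCommGroup.toIntModule _ := Subsingleton.elim _ _
  obtain rfl : iF = AddCommGroup.toIntModule _ := Subsingleton.elim _ _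
  exact mem_ker_of_forall_pairing_eq_zero_canonical κ hκ π hx

/-- **The annihilator of a kernel is the image of the adjoint**, arbitrary `Module ℤ` instances
(see `mem_range_iff_forall_mem_ker_pairing_eq_zero_canonical`).
[cite: WallJLMS1964, §2 p. 145] [cite: HatcherAT2002, §3.1 pp. 195–201] -/
theorem mem_range_iff_forall_mem_ker_pairing_eq_zero {Ac Bc Ah Bh : Type*} [AddCommGroup Ac]
    [iAc : Module ℤ Ac] [AddCommGroup Bc] [iBc : Module ℤ Bc] [AddCommGroup Ah]
    [iAh : Module ℤ Ah] [AddCommGroup Bh] [iBh : Module ℤ Bh] [Module.Projective ℤ Bh]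
    (κA : Ac →ₗ[ℤ] Dual ℤ Ah) (κB : Bc →ₗ[ℤ] Dual ℤ Bh) {ih : Ah →ₗ[ℤ] Bh} (hih : Surjective ih)
    {ic : Bc →ₗ[ℤ] Ac} (hadj : ∀ b x, κA (ic b) x = κB b (ih x)) (hκA : Injective κA)
    (hκB : Surjective κB) (a : Ac) :
    a ∈ LinearMap.range ic ↔ ∀ x ∈ LinearMap.ker ih, κA a x = 0 := by
  obtain rfl : iAc = AddCommGroup.toIntModule _ := Subsingleton.elim _ _
  obtain rfl : iBc = AddCommGroup.toIntModule _ := Subsingleton.elim _ _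
  obtain rfl : iAh = AddCommGroup.toIntModule _ := Subsingleton.elim _ _
  obtain rfl : iBh = AddCommGroup.toIntModule _ := Subsingleton.elim _ _
  exact mem_range_iff_forall_mem_ker_pairing_eq_zero_canonical κA κB hih hadj hκA hκB a

/-- **The homological graph of `−α†` lies in every kernel whose annihilator lies in Wall's `K`**,
arbitrary `Module ℤ` instances (see `graphSubmodule_le_ker_of_forall_canonical`).
[cite: WallJLMS1964, §2 p. 146] -/
theorem graphSubmodule_le_ker_of_forall {C₁ C₂ Wc H₁ H₂ Wh F : Type*} [AddCommGroup C₁]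
    [i₁ : Module ℤ C₁] [AddCommGroup C₂] [i₂ : Module ℤ C₂] [AddCommGroup Wc] [iWc : Module ℤ Wc]
    [AddCommGroup H₁] [j₁ : Module ℤ H₁] [AddCommGroup H₂] [j₂ : Module ℤ H₂] [AddCommGroup Wh]
    [iWh : Module ℤ Wh] [AddCommGroup F] [iF : Module ℤ F] [Module.Projective ℤ F]
    (κ : Wc →ₗ[ℤ] Wh →ₗ[ℤ] ℤ) (hκs : Surjective κ) (κ₁ : C₁ →ₗ[ℤ] H₁ →ₗ[ℤ] ℤ)
    (κ₂ : C₂ →ₗ[ℤ] H₂ →ₗ[ℤ] ℤ) {sc : Wc →ₗ[ℤ] C₁} {tc : Wc →ₗ[ℤ] C₂} {sh : Wh →ₗ[ℤ] H₁}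
    {th : Wh →ₗ[ℤ] H₂} (hκ : ∀ w x, κ w x = κ₁ (sc w) (sh x) + κ₂ (tc w) (th x))
    {e : C₁ →ₗ[ℤ] C₂} {e' : H₂ →ₗ[ℤ] H₁} (he : ∀ a y, κ₂ (e a) y = κ₁ a (e' y))
    (π : Wh →ₗ[ℤ] F)
    (hK : ∀ a : Wc, (∀ d ∈ LinearMap.ker π, κ a d = 0) → a ∈ graphSubmodule sc tc e) :
    graphSubmodule th sh (-e') ≤ LinearMap.ker π := by
  obtain rfl : i₁ = AddCommGroup.toIntModule _ := Subsingleton.elim _ _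
  obtain rfl : i₂ = AddCommGroup.toIntModule _ := Subsingleton.elim _ _
  obtain rfl : iWc = AddCommGroup.toIntModule _ := Subsingleton.elim _ _
  obtain rfl : j₁ = AddCommGroup.toIntModule _ := Subsingleton.elim _ _
  obtain rfl : j₂ = AddCommGroup.toIntModule _ := Subsingleton.elim _ _
  obtain rfl : iWh = AddCommGroup.toIntModule _ := Subsingleton.elim _ _
  obtain rfl : iF = AddCommGroup.toIntModule _ := Subsingleton.elim _ _
  exact graphSubmodule_le_ker_of_forall_canonical κ hκs κ₁ κ₂ hκ he π hK

end Export

end Literature.Topology.FourManifolds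

end
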